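import Summits.ABC.ABC.Theses.NegOmegaAtlas
import Summits.ABC.ABC.Theorems.IneffectiveSubspaceUniformSadicTowerFourKillPaths

/-!
# `NegOmegaAtlas.AtlasDichotomy` (stmt-ABC-1228): `NegThesis ↔ UnbalancedFamily ∨ BalancedFamily`

Pure logic on the infinite violator set (fix `k, δ`; either some `η > 0` gives an infinite unbalanced
part, or for every `η` the unbalanced part is finite and its complement inside the infinite violator set is
infinite).  The converse arrows are the landed `BoundedOmega.negThesis_of_unbalancedFamily /
negThesis_of_balancedFamily` (p150546, crux chain of `IneffectiveSubspace.UniformSadicTowerFour`,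
stmt-ABC-14937, whose normal form modulo crux #6 is `¬NegThesis`).  Nothing else is in this file.
-/

-- `Summit.<Summit>.<Problem>` is the mandated summit-side namespace (CONVENTIONS §2); for the
-- single-conjunct summit `ABC` the two coincide, so the duplicate `ABC.ABC` is deliberate.
set_option linter.dupNamespace false

namespace Summit.ABC.ABC.Theorems

open Literature.NumberTheory.DiophantineGeometry (IsABCTriple quality)
open Summit.ABC.ABC.Theses.NegOmegaAtlas (NegThesis UnbalancedFamily BalancedFamily)
open Summit.ABC.ABC.Theorems.UniformSadicTowerFour.BoundedOmega
  (negThesis_of_unbalancedFamily negThesis_of_balancedFamily)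

/-- **`NegOmegaAtlas.AtlasDichotomy` holds**: the bounded-ω atlas has no fourth cell —
`NegThesis ↔ UnbalancedFamily ∨ BalancedFamily`. [folklore] -/
theorem atlasDichotomy_proof : Summit.ABC.ABC.Theses.NegOmegaAtlas.AtlasDichotomy := by
  unfold Summit.ABC.ABC.Theses.NegOmegaAtlas.AtlasDichotomy
  refine ⟨fun h => ?_, fun h => h.elim negThesis_of_unbalancedFamily negThesis_of_balancedFamily⟩
  obtain ⟨k, δ, hδ, hV⟩ := h
  by_cases hU : ∃ η : ℝ, 0 < η ∧ {t : ℕ × ℕ × ℕ | IsABCTriple t.1 t.2.1 t.2.2 ∧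
      (t.1 * t.2.1 * t.2.2).primeFactors.card ≤ k ∧
      ((min t.1 t.2.1 : ℕ) : ℝ) ≤ (t.2.2 : ℝ) ^ (1 - η) ∧ 1 + δ < quality t.1 t.2.1 t.2.2}.Infinite
  · obtain ⟨η, hη, hinf⟩ := hU
    exact Or.inl ⟨k, η, hη, δ, hδ, hinf⟩
  · right
    refine ⟨k, δ, hδ, fun η hη => ?_⟩
    have hfin : {t : ℕ × ℕ × ℕ | IsABCTriple t.1 t.2.1 t.2.2 ∧
        (t.1 * t.2.1 * t.2.2).primeFactors.card ≤ k ∧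
        ((min t.1 t.2.1 : ℕ) : ℝ) ≤ (t.2.2 : ℝ) ^ (1 - η) ∧ 1 + δ < quality t.1 t.2.1 t.2.2}.Finite := by
      by_contra hinf
      exact hU ⟨η, hη, hinf⟩
    refine (hV.sdiff hfin).mono ?_
    rintro ⟨a, b, c⟩ ⟨⟨ht, hω, hq⟩, hnot⟩
    refine ⟨ht, hω, ?_, hq⟩
    by_contra hle
    exact hnot ⟨ht, hω, not_lt.mp hle, hq⟩

end Summit.ABC.ABC.Theorems
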